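import Summits.BirchSwinnertonDyer.Rank2.Chi8FloorPeriodFree
import HarnessLib

/-!
# The χ₈-floor kernel, Part G of 8 — §TwistDoorFinal

Planner p2 GEN 40–42 kernel `Chi8Floor` v10 (cell bsd-rank2, HOME/p2/g43/lean/Chi8Floor_v10.lean, sha bc257584; 60 theorems, `lean check` rc 0 / 0 sorry),
split into ≤400-line tree files `Rank2/Chi8Floor{Certificate,ConductorLevel,TwistDoor,LatticeEngine,TwistDoorProved,PeriodFree,TwistDoorFinal,KatoFree}`
(A–H, a linear import chain) by the lead star-p1 GEN 18 at the planner's LANDING ASK.  The mathematical overview, the honest framing (Barrier B1: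
`ord_{T=0} L₂` is the 2-adic analytic order, never `r_an`; BSD is not proved) and the references are in Part A's module docstring
(`Rank2/Chi8FloorCertificate.lean`); every theorem below carries its own `[cite: …]` tags.  Theorems only; no definition, no named fact, no instance.
[cite: MazurTateTeitelbaum1986Invent, §I.14 Proposition (p. 20)] [cite: Kato2004Asterisque, Thm. 18.4 (p. 281)] [cite: GreenbergLNM1716, §5 (p. 181)]
[cite: Stevens1989, Lemma (5.4)]
-/

noncomputable section

open PowerSeries WeierstrassCurve CongruenceSubgroup Filter
open Literature.NumberTheory.EllipticCurves Literature.NumberTheory.EllipticCurves.ModularForms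
open Literature.Barriers.BirchSwinnertonDyer

namespace Summit.BirchSwinnertonDyer.Rank2

section TwistDoorFinal

/-! ### THE DOOR, final form: analytic inputs, no period hypothesis

Inputs (all print-standard): `E₀`'s rational newform `f₀` of odd level `N₀` with `[1/8]⁺_{f₀}` a
`2`-adic unit and rhombic period lattice (`Λ(f₀) ∩ ℝ = ℤΩ⁺`, i.e. `Δ(E₀) < 0`); a prime `q ≡ 1 (4)`,
`q ∤ 2N₀`, with `a_q(f₀)` odd; the quadratic twist `F = f₀ ⊗ χ_q` (newform of `E = E₀^{(q)}`, `W` its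
minimal model, good ordinary at `2`); the central vanishings `L(f₀,1) = L(f₀,χ₋₄,1) = L(f₀,χ₋₈,1) =
L(F,χ₋₄,1) = L(F,χ₋₈,1) = 0` (sign-forced). Conclusions: `L(E,1) = 0 ⇒ ord_{T=0} L₂(E,T) ≤ 2`
(any level); at the conductor level with `w_E = +1`: `ord = 2` exactly; with Kato's divisibility at `2`
and `rank E(ℚ) ≥ 2`: `rank = corank Sel_{2^∞} = ord = 2`, `Ш[2^∞]` finite; with a `2`-descent instead of
Kato: `corank Sel_{2^∞} = ord = rank = 2`. -/

variable {N₀ : ℕ} [NeZero N₀] {q : ℕ} [NeZero q]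

section AnyLevel'
variable (L : ℕ) [NeZero L] {W : WeierstrassCurve ℚ} [W.IsElliptic] [W.IsGloballyMinimal]

/-- **Door, any level, analytic half**: `L(E,1) = 0 ⇒ ord_{T=0} L₂(E,T) ≤ 2` for `E = E₀^{(q)}`.
[cite: MazurTateTeitelbaum1986Invent, §I.8, §I.14] [cite: Stevens1989, Lemma (5.4)] [cite: Birch1971] -/
theorem order_padicLFunction_le_two_of_twistDoor (hN : N₀ ∣ L) (hm : q ^ 2 ∣ L)
    {χ : DirichletCharacter ℂ q} (hχ : χ.IsQuadratic) (hχe : χ.Even) (hχp : χ.IsPrimitive)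
    {f₀ : CuspForm (Gamma0 N₀) 2} (hf₀ : IsNewform0 f₀) (hQ₀ : coeffField f₀ = ⊥) (hN2 : ¬ 2 ∣ N₀)
    (hL2 : ¬ 2 ∣ L) (hord : IsOrdinaryAt W 2) (hF : IsNewformOf W (charTwist L hN hm hχ f₀))
    (hL : W.entireLFunction 1 = 0)
    (hq : q.Prime) (hq2 : q ≠ 2) (hqN : ¬ q ∣ N₀) {a : ℤ} (ha : cuspCoeff f₀ q = a) (hodd : Odd a)
    {a₂ : ℤ} (ha₂ : cuspCoeff f₀ 2 = a₂)
    (h18 : ‖((ratPlusSymbol f₀ (1 / 8) : ℚ) : ℚ_[2])‖ = 1)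
    (hZ0 : ∃ Λ : ℂ → ℂ, Differentiable ℂ Λ ∧ (∀ s : ℂ, 2 < s.re → Λ s = cuspFormLSeries f₀ s) ∧
      Λ 1 = 0)
    (hZ4 : ∃ Λ : ℂ → ℂ, Differentiable ℂ Λ ∧
      (∀ s : ℂ, 2 < s.re → Λ s = twistedLSeries f₀ (ZMod.χ₄.ringHomComp (Int.castRingHom ℂ)) s) ∧
      Λ 1 = 0)
    (hZ8 : ∃ Λ : ℂ → ℂ, Differentiable ℂ Λ ∧
      (∀ s : ℂ, 2 < s.re → Λ s = twistedLSeries f₀ (ZMod.χ₈'.ringHomComp (Int.castRingHom ℂ)) s) ∧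
      Λ 1 = 0)
    (hZ4F : ∃ Λ : ℂ → ℂ, Differentiable ℂ Λ ∧
      (∀ s : ℂ, 2 < s.re → Λ s = twistedLSeries (charTwist L hN hm hχ f₀)
        (ZMod.χ₄.ringHomComp (Int.castRingHom ℂ)) s) ∧ Λ 1 = 0)
    (hZ8F : ∃ Λ : ℂ → ℂ, Differentiable ℂ Λ ∧
      (∀ s : ℂ, 2 < s.re → Λ s = twistedLSeries (charTwist L hN hm hχ f₀)
        (ZMod.χ₈'.ringHomComp (Int.castRingHom ℂ)) s) ∧ Λ 1 = 0)
    (hΛ : ∀ z ∈ periodLattice f₀, z.im = 0 → ∃ k : ℤ, z = k * (plusPeriod f₀ : ℂ)) :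
    (padicLFunction (charTwist L hN hm hχ f₀) (unitRoot W 2 : ℚ_[2])).order ≤ (2 : ℕ) := by
  have h1 := one_le_norm_ratPlusSymbol_charTwist_eighth_of_forcedZeros L hN hm hχ hχe hχp hf₀ hQ₀ hN2
    hL2 hF.1 hF.coeffField_eq_bot hq hq2 hqN ha hodd ha₂ h18 (modularSymbol_zero_eq_zero_of_LValue f₀ hZ0)
    (modularSymbol_quarters_eq_zero_of_twistedLValue_χ₄ f₀ hZ4)
    (modularSymbol_eighths_eq_zero_of_twistedLValue_χ₈' f₀ hZ8)
    (modularSymbol_quarters_eq_zero_of_twistedLValue_χ₄ _ hZ4F)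
    (modularSymbol_eighths_eq_zero_of_twistedLValue_χ₈' _ hZ8F) hΛ
  have hS := chi8Floor_of_eighthSymbol hord hF hL 1 (lt_of_lt_of_le (by norm_num) h1)
  exact order_padicLFunction_le_of_chi8Floor hord hF 2 0
    (fun k ↦ by simpa using padicLFunction_integral_two_auto hord hF k) (by simpa using hS)

/-- **Door, any level, with Kato's divisibility at `2` and planted rank `≥ 2`**:
`rank E(ℚ) = corank Sel_{2^∞}(E) = ord_{T=0} L₂(E,T) = 2`, `Ш(E)[2^∞]` of corank `0`.
[cite: Kato2004Asterisque, Thm. 18.4 (p. 281)] [cite: MazurTateTeitelbaum1986Invent, §I.8, §I.14]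
[cite: Stevens1989, Lemma (5.4)] -/
theorem rank_eq_two_of_twistDoor (hN : N₀ ∣ L) (hm : q ^ 2 ∣ L)
    {χ : DirichletCharacter ℂ q} (hχ : χ.IsQuadratic) (hχe : χ.Even) (hχp : χ.IsPrimitive)
    {f₀ : CuspForm (Gamma0 N₀) 2} (hf₀ : IsNewform0 f₀) (hQ₀ : coeffField f₀ = ⊥) (hN2 : ¬ 2 ∣ N₀)
    (hL2 : ¬ 2 ∣ L) (hord : IsOrdinaryAt W 2) (hF : IsNewformOf W (charTwist L hN hm hχ f₀))
    (hq : q.Prime) (hq2 : q ≠ 2) (hqN : ¬ q ∣ N₀) {a : ℤ} (ha : cuspCoeff f₀ q = a) (hodd : Odd a)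
    {a₂ : ℤ} (ha₂ : cuspCoeff f₀ 2 = a₂)
    (h18 : ‖((ratPlusSymbol f₀ (1 / 8) : ℚ) : ℚ_[2])‖ = 1)
    (hZ0 : ∃ Λ : ℂ → ℂ, Differentiable ℂ Λ ∧ (∀ s : ℂ, 2 < s.re → Λ s = cuspFormLSeries f₀ s) ∧
      Λ 1 = 0)
    (hZ4 : ∃ Λ : ℂ → ℂ, Differentiable ℂ Λ ∧
      (∀ s : ℂ, 2 < s.re → Λ s = twistedLSeries f₀ (ZMod.χ₄.ringHomComp (Int.castRingHom ℂ)) s) ∧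
      Λ 1 = 0)
    (hZ8 : ∃ Λ : ℂ → ℂ, Differentiable ℂ Λ ∧
      (∀ s : ℂ, 2 < s.re → Λ s = twistedLSeries f₀ (ZMod.χ₈'.ringHomComp (Int.castRingHom ℂ)) s) ∧
      Λ 1 = 0)
    (hZ4F : ∃ Λ : ℂ → ℂ, Differentiable ℂ Λ ∧
      (∀ s : ℂ, 2 < s.re → Λ s = twistedLSeries (charTwist L hN hm hχ f₀)
        (ZMod.χ₄.ringHomComp (Int.castRingHom ℂ)) s) ∧ Λ 1 = 0)
    (hZ8F : ∃ Λ : ℂ → ℂ, Differentiable ℂ Λ ∧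
      (∀ s : ℂ, 2 < s.re → Λ s = twistedLSeries (charTwist L hN hm hχ f₀)
        (ZMod.χ₈'.ringHomComp (Int.castRingHom ℂ)) s) ∧ Λ 1 = 0)
    (hΛ : ∀ z ∈ periodLattice f₀, z.im = 0 → ∃ k : ℤ, z = k * (plusPeriod f₀ : ℂ))
    (hKato : kato_selmerCorank_le_order_padicLFunction_allPrimes W 2 (f := charTwist L hN hm hχ f₀))
    (hrank : 2 ≤ W.mordellWeilRank) :
    W.mordellWeilRank = 2 ∧ W.selmerCorank 2 = 2 ∧ W.shaCorank 2 = 0 ∧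
      (padicLFunction (charTwist L hN hm hχ f₀) (unitRoot W 2 : ℚ_[2])).order = (2 : ℕ) := by
  have h1 := one_le_norm_ratPlusSymbol_charTwist_eighth_of_forcedZeros L hN hm hχ hχe hχp hf₀ hQ₀ hN2
    hL2 hF.1 hF.coeffField_eq_bot hq hq2 hqN ha hodd ha₂ h18 (modularSymbol_zero_eq_zero_of_LValue f₀ hZ0)
    (modularSymbol_quarters_eq_zero_of_twistedLValue_χ₄ f₀ hZ4)
    (modularSymbol_eighths_eq_zero_of_twistedLValue_χ₈' f₀ hZ8)
    (modularSymbol_quarters_eq_zero_of_twistedLValue_χ₄ _ hZ4F)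
    (modularSymbol_eighths_eq_zero_of_twistedLValue_χ₈' _ hZ8F) hΛ
  exact rank_eq_selmerCorank_eq_order_of_eighthSymbol₀ hord hF 1 (lt_of_lt_of_le (by norm_num) h1)
    hKato hrank

end AnyLevel'

section ConductorLevel'
variable {W : WeierstrassCurve ℚ} [W.IsElliptic] [W.IsGloballyMinimal] [NeZero (W.conductorNorm ℤ)]

/-- **Door, conductor level, Kato-free**: `w_E = +1`, `L(E,1) = 0 ⇒ ord_{T=0} L₂(E,T) = 2` exactly.
[cite: MazurTateTeitelbaum1986Invent, §I.8, §I.14, §I.17–18] [cite: Stevens1989, Lemma (5.4)] -/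
theorem order_padicLFunction_eq_two_of_twistDoor
    (hN : N₀ ∣ W.conductorNorm ℤ) (hm : q ^ 2 ∣ W.conductorNorm ℤ)
    {χ : DirichletCharacter ℂ q} (hχ : χ.IsQuadratic) (hχe : χ.Even) (hχp : χ.IsPrimitive)
    {f₀ : CuspForm (Gamma0 N₀) 2} (hf₀ : IsNewform0 f₀) (hQ₀ : coeffField f₀ = ⊥) (hN2 : ¬ 2 ∣ N₀)
    (hL2 : ¬ 2 ∣ W.conductorNorm ℤ) (hord : IsOrdinaryAt W 2)
    (hF : IsNewformOf W (charTwist (W.conductorNorm ℤ) hN hm hχ f₀))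
    (hw : W.rootNumber = 1) (hL : W.entireLFunction 1 = 0)
    (hq : q.Prime) (hq2 : q ≠ 2) (hqN : ¬ q ∣ N₀) {a : ℤ} (ha : cuspCoeff f₀ q = a) (hodd : Odd a)
    {a₂ : ℤ} (ha₂ : cuspCoeff f₀ 2 = a₂)
    (h18 : ‖((ratPlusSymbol f₀ (1 / 8) : ℚ) : ℚ_[2])‖ = 1)
    (hZ0 : ∃ Λ : ℂ → ℂ, Differentiable ℂ Λ ∧ (∀ s : ℂ, 2 < s.re → Λ s = cuspFormLSeries f₀ s) ∧
      Λ 1 = 0)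
    (hZ4 : ∃ Λ : ℂ → ℂ, Differentiable ℂ Λ ∧
      (∀ s : ℂ, 2 < s.re → Λ s = twistedLSeries f₀ (ZMod.χ₄.ringHomComp (Int.castRingHom ℂ)) s) ∧
      Λ 1 = 0)
    (hZ8 : ∃ Λ : ℂ → ℂ, Differentiable ℂ Λ ∧
      (∀ s : ℂ, 2 < s.re → Λ s = twistedLSeries f₀ (ZMod.χ₈'.ringHomComp (Int.castRingHom ℂ)) s) ∧
      Λ 1 = 0)
    (hZ4F : ∃ Λ : ℂ → ℂ, Differentiable ℂ Λ ∧
      (∀ s : ℂ, 2 < s.re → Λ s = twistedLSeries (charTwist (W.conductorNorm ℤ) hN hm hχ f₀)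
        (ZMod.χ₄.ringHomComp (Int.castRingHom ℂ)) s) ∧ Λ 1 = 0)
    (hZ8F : ∃ Λ : ℂ → ℂ, Differentiable ℂ Λ ∧
      (∀ s : ℂ, 2 < s.re → Λ s = twistedLSeries (charTwist (W.conductorNorm ℤ) hN hm hχ f₀)
        (ZMod.χ₈'.ringHomComp (Int.castRingHom ℂ)) s) ∧ Λ 1 = 0)
    (hΛ : ∀ z ∈ periodLattice f₀, z.im = 0 → ∃ k : ℤ, z = k * (plusPeriod f₀ : ℂ)) :
    (padicLFunction (charTwist (W.conductorNorm ℤ) hN hm hχ f₀) (unitRoot W 2 : ℚ_[2])).order = 2 := by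
  have h1 := one_le_norm_ratPlusSymbol_charTwist_eighth_of_forcedZeros (W.conductorNorm ℤ) hN hm hχ
    hχe hχp hf₀ hQ₀ hN2 hL2 hF.1 hF.coeffField_eq_bot hq hq2 hqN ha hodd ha₂ h18
    (modularSymbol_zero_eq_zero_of_LValue f₀ hZ0)
    (modularSymbol_quarters_eq_zero_of_twistedLValue_χ₄ f₀ hZ4)
    (modularSymbol_eighths_eq_zero_of_twistedLValue_χ₈' f₀ hZ8)
    (modularSymbol_quarters_eq_zero_of_twistedLValue_χ₄ _ hZ4F)
    (modularSymbol_eighths_eq_zero_of_twistedLValue_χ₈' _ hZ8F) hΛ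
  exact order_padicLFunction_eq_two_of_eighthSymbol₀ hord hF hw hL (lt_of_lt_of_le (by norm_num) h1)

/-- **Door, conductor level, descent form**: + `rank E(ℚ) = 2`, `corank Ш[2^∞] = 0` (a `2`-descent) ⇒
`corank Sel_{2^∞}(E) = ord_{T=0} L₂(E,T) = rank E(ℚ) = 2` — the rank part of `2`-adic BSD for `E`.
[cite: MazurTateTeitelbaum1986Invent, §I.8, §I.14] [cite: Greenberg1999LNM, §1 pp. 54–57]
[cite: Stevens1989, Lemma (5.4)] -/
theorem twoAdicBSD_rank_of_twistDoor_descent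
    (hN : N₀ ∣ W.conductorNorm ℤ) (hm : q ^ 2 ∣ W.conductorNorm ℤ)
    {χ : DirichletCharacter ℂ q} (hχ : χ.IsQuadratic) (hχe : χ.Even) (hχp : χ.IsPrimitive)
    {f₀ : CuspForm (Gamma0 N₀) 2} (hf₀ : IsNewform0 f₀) (hQ₀ : coeffField f₀ = ⊥) (hN2 : ¬ 2 ∣ N₀)
    (hL2 : ¬ 2 ∣ W.conductorNorm ℤ) (hord : IsOrdinaryAt W 2)
    (hF : IsNewformOf W (charTwist (W.conductorNorm ℤ) hN hm hχ f₀))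
    (hw : W.rootNumber = 1) (hL : W.entireLFunction 1 = 0)
    (hq : q.Prime) (hq2 : q ≠ 2) (hqN : ¬ q ∣ N₀) {a : ℤ} (ha : cuspCoeff f₀ q = a) (hodd : Odd a)
    {a₂ : ℤ} (ha₂ : cuspCoeff f₀ 2 = a₂)
    (h18 : ‖((ratPlusSymbol f₀ (1 / 8) : ℚ) : ℚ_[2])‖ = 1)
    (hZ0 : ∃ Λ : ℂ → ℂ, Differentiable ℂ Λ ∧ (∀ s : ℂ, 2 < s.re → Λ s = cuspFormLSeries f₀ s) ∧
      Λ 1 = 0)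
    (hZ4 : ∃ Λ : ℂ → ℂ, Differentiable ℂ Λ ∧
      (∀ s : ℂ, 2 < s.re → Λ s = twistedLSeries f₀ (ZMod.χ₄.ringHomComp (Int.castRingHom ℂ)) s) ∧
      Λ 1 = 0)
    (hZ8 : ∃ Λ : ℂ → ℂ, Differentiable ℂ Λ ∧
      (∀ s : ℂ, 2 < s.re → Λ s = twistedLSeries f₀ (ZMod.χ₈'.ringHomComp (Int.castRingHom ℂ)) s) ∧
      Λ 1 = 0)
    (hZ4F : ∃ Λ : ℂ → ℂ, Differentiable ℂ Λ ∧
      (∀ s : ℂ, 2 < s.re → Λ s = twistedLSeries (charTwist (W.conductorNorm ℤ) hN hm hχ f₀)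
        (ZMod.χ₄.ringHomComp (Int.castRingHom ℂ)) s) ∧ Λ 1 = 0)
    (hZ8F : ∃ Λ : ℂ → ℂ, Differentiable ℂ Λ ∧
      (∀ s : ℂ, 2 < s.re → Λ s = twistedLSeries (charTwist (W.conductorNorm ℤ) hN hm hχ f₀)
        (ZMod.χ₈'.ringHomComp (Int.castRingHom ℂ)) s) ∧ Λ 1 = 0)
    (hΛ : ∀ z ∈ periodLattice f₀, z.im = 0 → ∃ k : ℤ, z = k * (plusPeriod f₀ : ℂ))
    (hrank : W.mordellWeilRank = 2) (hsha : W.shaCorank 2 = 0) :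
    W.selmerCorank 2 = 2 ∧
      (padicLFunction (charTwist (W.conductorNorm ℤ) hN hm hχ f₀) (unitRoot W 2 : ℚ_[2])).order = 2 ∧
      W.mordellWeilRank = 2 := by
  refine ⟨?_, ?_, hrank⟩
  · rw [W.selmerCorank_eq_mordellWeilRank_add_holds 2, hrank, hsha]
  · exact order_padicLFunction_eq_two_of_twistDoor hN hm hχ hχe hχp hf₀ hQ₀ hN2 hL2 hord hF hw hL hq hq2
      hqN ha hodd ha₂ h18 hZ0 hZ4 hZ8 hZ4F hZ8F hΛ

end ConductorLevel'

end TwistDoorFinal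

end Summit.BirchSwinnertonDyer.Rank2

end
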